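import Literature.AlgebraicGeometry.HodgeTheory.ProjectiveSpaceFormsRestrictedToHypersurface
import Literature.AlgebraicGeometry.HodgeTheory.ProjectiveSpaceFormsHilbertPolynomial
import Literature.Algebra.Polynomial.PolynomialShiftDifference
import HarnessLib

/-!
# The Hilbert polynomial of the ambient twisted forms restricted to a hypersurface:
# `χ(Ω^p_{ℙ^r}(z)|_Y) = Q_p(z) - Q_p(z - d)`

Carlson–Müller-Stach–Peters, *Period Mappings and Period Domains* (2nd ed., 2017), proof of
Thm. 8.1.7 (restriction sequences `0 → Ω_X^{p}(k-d) → Ω_X^{p}(k) → Ω_X^{p}(k)|Y → 0` for a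
hypersurface section `Y = X ∩ H`, `deg H = d`); Hartshorne, *Algebraic Geometry*, I Thm. 7.7
(proof, p. 53): "taking Hilbert polynomials, we find that `P_{Y ∩ H}(z) = P_Y(z) - P_Y(z - d)` …
Comparing the leading coefficients"; Okonek–Schneider–Spindler, Ch. I § 1.1 (Bott's formula).

For a hypersurface `Y = V₊(f) ⊂ ℙ_r(ℂ)` of degree `d` (`f ≠ 0` homogeneous) and the sheaves
`Ω^p_{ℙ_r}(k)|_Y` of `ProjectiveSpaceFormsRestrictedToHypersurface` (the cokernel complexes of
`f· : Č_{k-d}(Z_p) → Č_k(Z_p)`), with `Q_p = preHilbertPoly ℚ (r-p) 0 · (newtonBinom ℚ p)(z-1)` the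
Hilbert polynomial of `Ω^p_{ℙ^r}` (`ProjectiveSpaceFormsHilbertPolynomial.eulerChar_cech_Zsub_eq_eval`,
`χ(Č_k(Ω^p)) = C(k+r-p, r-p)·C(k-1, p)`):

* **`eulerChar_restrictForms_eq_eval`** — **`χ(Ω^p_{ℙ_r}(k)|_Y) = (Q_p - Q_p(z - d))(k)` for every
  `k ∈ ℤ`** (`r ≥ 1`, `p ≤ r`);
* `natDegree_hilbertPolynomial_restrictForms`, `factorial_mul_leadingCoeff_hilbertPolynomial_restrictForms`
  — that polynomial has degree `r - 1` and `(r-1)!·lc = d · C(r, p)` (`d ≠ 0`): the restricted bundle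
  has rank `C(r,p)` on the degree-`d` hypersurface, "degree" `d·C(r,p)` in the sense of I §7.

Theorems only; no definitions, no named facts (the twist `k - d` is written `m` with `m + d = k`
as in the restriction sequence).

## References
* [CarlsonMullerStachPeters2017] J. Carlson, S. Müller-Stach, C. Peters, *Period Mappings and
  Period Domains*, 2nd ed. (2017), Thm. 8.1.7 (proof).
* [Hartshorne1977] R. Hartshorne, *Algebraic Geometry*, GTM 52 (1977), I Thm. 7.7 (proof, p. 53),
  I §7 Definition (p. 52), III Ex. 5.2 (p. 230).
* [OkonekSchneiderSpindler1980] C. Okonek, M. Schneider, H. Spindler, *Vector Bundles on Complex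
  Projective Spaces* (1980), Ch. I § 1.1 (p. 8).
-/

noncomputable section

open CategoryTheory CategoryTheory.Limits Polynomial
open scoped Nat

namespace Literature.AlgebraicGeometry.HodgeTheory

namespace GAGAForms

open Literature.Algebra.Homology Literature.Algebra.Homology.LaurentCech
  Literature.Algebra.Homology.KoszulCech Literature.Algebra.Homology.OrderedCech
  Literature.Algebra.Homology.TopCohomology
open Literature.Algebra.Polynomial.PolynomialShiftDifference
open Literature.Algebra.Polynomial.IntegerValuedPolynomials

variable {r : ℕ} (p : ℕ) (f : P ℂ r) {d : ℤ} (hfd : toL ℂ r f ∈ Ldeg ℂ r d) (hf : f ≠ 0)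
  (m k : ℤ) (h : m + d = k)

include hf in
/-- **`χ(Ω^p_{ℙ_r}(k)|_Y) = Q_p(k) - Q_p(k - d)` for every `k ∈ ℤ`** (`Y = V₊(f)`, `deg f = d`,
`f ≠ 0`; `r ≥ 1`, `p ≤ r`; `Q_p` the Hilbert polynomial of `Ω^p_{ℙ^r}`): additivity of `χ` on the
restriction sequence and Bott's formula on both ambient terms.
[cite: CarlsonMullerStachPeters2017, Thm. 8.1.7 (proof)] [cite: Hartshorne1977, I Thm. 7.7 (proof, p. 53)]
[cite: OkonekSchneiderSpindler1980, Ch. I § 1.1 (p. 8)] -/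
theorem eulerChar_restrictForms_eq_eval (hr : 1 ≤ r) (hp : p ≤ r) :
    ((∑ q ∈ Finset.range (r + 1), (-1 : ℤ) ^ q * (Module.finrank ℂ ((cokernel (smulMap
        (fun _ : Sub (Fin (r + 1)) p => (p : ℤ)) (Zsub r p) f hfd m k h)).homology q) : ℤ) : ℤ) :
          ℚ) =
      ((preHilbertPoly ℚ (r - p) 0 * (newtonBinom ℚ p).comp (X - C 1)) -
        (preHilbertPoly ℚ (r - p) 0 * (newtonBinom ℚ p).comp (X - C 1)).comp
          (X - C (d : ℚ))).eval (k : ℚ) := by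
  rw [eulerChar_restrictForms p f hfd hf m k h, Int.cast_sub, eulerChar_cech_Zsub_eq_eval hr hp k,
    eulerChar_cech_Zsub_eq_eval hr hp m, eval_sub_comp_X_sub_C, ← h, Int.cast_add, add_sub_cancel_right]

/-- **The Hilbert polynomial `Q_p - Q_p(z - d)` of `Ω^p_{ℙ_r}|_Y` has degree `r - 1`** (`d ≠ 0`,
`r ≥ 1`, `p ≤ r`; the support `Y` has dimension `r - 1`).
[cite: Hartshorne1977, I Thm. 7.7 (proof, p. 53)] [cite: Hartshorne1977, I Prop. 7.6 (d) (p. 52)] -/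
theorem natDegree_hilbertPolynomial_restrictForms (hr : 1 ≤ r) (hp : p ≤ r) (hd : d ≠ 0) :
    ((preHilbertPoly ℚ (r - p) 0 * (newtonBinom ℚ p).comp (X - C 1)) -
        (preHilbertPoly ℚ (r - p) 0 * (newtonBinom ℚ p).comp (X - C 1)).comp
          (X - C (d : ℚ))).natDegree = r - 1 := by
  rw [natDegree_sub_comp_X_sub_C _ (Int.cast_ne_zero.2 hd)
    (by rw [(natDegree_hilbertPolynomial_forms hp).1]; exact hr),
    (natDegree_hilbertPolynomial_forms hp).1]

/-- **`(r-1)! · lc(Q_p - Q_p(z - d)) = d · C(r, p)`**: in the normalization of Hartshorne I §7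
(degree of an `(r-1)`-dimensional support `= (r-1)!·` leading coefficient), the restricted bundle
`Ω^p_{ℙ_r}|_Y` of rank `C(r,p)` on the degree-`d` hypersurface `Y` has "degree" `d·C(r,p)`
("Comparing the leading coefficients"). [cite: Hartshorne1977, I Thm. 7.7 (proof, p. 53)]
[cite: Hartshorne1977, I §7 Definition (p. 52)] -/
theorem factorial_mul_leadingCoeff_hilbertPolynomial_restrictForms (hr : 1 ≤ r) (hp : p ≤ r)
    (hd : d ≠ 0) :
    ((r - 1)! : ℚ) * ((preHilbertPoly ℚ (r - p) 0 * (newtonBinom ℚ p).comp (X - C 1)) -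
        (preHilbertPoly ℚ (r - p) 0 * (newtonBinom ℚ p).comp (X - C 1)).comp
          (X - C (d : ℚ))).leadingCoeff = (d : ℚ) * (r.choose p : ℚ) := by
  have hdeg := (natDegree_hilbertPolynomial_forms (r := r) hp).1
  have h1 : 1 ≤ (preHilbertPoly ℚ (r - p) 0 * (newtonBinom ℚ p).comp (X - C (1 : ℚ))).natDegree := by
    rw [hdeg]; exact hr
  have key := factorial_mul_leadingCoeff_sub_comp_X_sub_C
    (preHilbertPoly ℚ (r - p) 0 * (newtonBinom ℚ p).comp (X - C (1 : ℚ))) (Int.cast_ne_zero.2 hd) h1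
  rw [hdeg, factorial_mul_leadingCoeff_hilbertPolynomial_forms hp] at key
  exact key

end GAGAForms

end Literature.AlgebraicGeometry.HodgeTheory

end
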